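import Summits.Langlands.Langlands.Statement
import Summits.Langlands.Langlands.Theorems.IrreducibilityBySelfDualityIrreducibleOffSectorIotaTransport
import Literature.FieldTheory.AlgClosed.AutomorphismExtension
import Literature.FieldTheory.AlgClosed.PadicAlgClEquivComplex
import Literature.NumberTheory.GaloisRepresentations.GaloisRepFrobeniusProofs
import HarnessLib

/-!
# Route EisensteinGelfandKirillov — `SectorComplement` (stmt-Langlands-18275): PARTNER TRANSPORT
(line `Sketch-18275-r1-k1`; `--supports` file; no definitions)

Transport of Satake–Frobenius compatibility along an `E`-rational compatible family, in the
conjugation-free "`∃ ι'`" form.  Let `E` be a field with embeddings `e_p : E → ℚ̄_p`,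
`e_ℓ : E → ℚ̄_ℓ`, and let `ρ : Γ_K → GL_n(ℚ̄_p)`, `ρ' : Γ_K → GL_n(ℚ̄_ℓ)` be PARTNERS over `E`:
at almost every finite place `v` of `K` one polynomial `P_v ∈ E[X]` is the Frobenius polynomial
of `ρ` read through `e_p` and of `ρ'` read through `e_ℓ` (and `ρ'` is unramified at `v`) — Serre's
strictly compatible `E`-rational systems.  If a `π` on `GL_n(𝔸_K)` is Satake–Frobenius compatible
a.e. with `ρ` through `ι : ℚ̄_p ≃ ℂ`, then:

* `eventually_satakeFrobCompatibleAt_of_partner_of_apply_eq` — `π` is Satake–Frobenius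
  compatible a.e. with `ρ'` through EVERY `ι' : ℚ̄_ℓ ≃ ℂ` agreeing with `ι` on `E`
  (`ι' ∘ e_ℓ = ι ∘ e_p`).  Pure polynomial algebra: by uniqueness of Frobenius polynomials
  `e_p(P_v) = ι⁻¹(S_v)` with `S_v = ∏ (X - α_j⁻¹)` the complex Satake polynomial, hence
  `S_v = (ι ∘ e_p)(P_v) = (ι' ∘ e_ℓ)(P_v)` and `e_ℓ(P_v) = ι'⁻¹(S_v)`;
* `exists_ringEquiv_eventually_satakeFrobCompatibleAt_of_partner` — for a NUMBER FIELD `E` such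
  an `ι'` exists: `ℚ̄_ℓ ≃ ℂ` abstractly (Steinitz, `PadicAlgCl.nonempty_ringEquiv_complex`) and
  two embeddings of the countable field `E` into `ℂ` differ by an automorphism of `ℂ`
  (`Literature.FieldTheory.AlgClosed.exists_ringEquiv_apply_eq`).

No Chebotarev, no irreducibility, no hypothesis on `ρ'` beyond the partnership.

References: J.-P. Serre, *Abelian ℓ-adic representations and elliptic curves* (1968), Ch. I §2.3
(compatible systems of `ℓ`-adic representations) [SerreAbelianLadic1968].
-/

noncomputable section

set_option linter.dupNamespace false -- project-wide option; `Summit.Langlands.Langlands` is the mandated namespace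

open scoped NumberField Classical Polynomial
open Filter IsDedekindDomain Polynomial
open Literature.NumberTheory.Automorphic Literature.NumberTheory.GaloisRepresentations
open Summit.Langlands

namespace Summit.Langlands.Langlands.Theorems.EisensteinEntry

/-- **Reading an `E`-rational polynomial through two `ι`'s that agree on `E`.**  If
`ι' ∘ e_ℓ = ι ∘ e_p` on `E` and `P ∈ E[X]` read in `ℚ̄_p[X]` through `e_p` is `ι⁻¹(S)` for a
complex polynomial `S`, then `P` read in `ℚ̄_ℓ[X]` through `e_ℓ` is `ι'⁻¹(S)`:
`e_ℓ = ι'⁻¹ ∘ ι ∘ e_p` and `S = (ι ∘ e_p)(P)` (`Polynomial.map_map`). [folklore] -/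
theorem map_eq_map_symm_of_map_eq_map_symm {p ℓ : ℕ} [Fact p.Prime] [Fact ℓ.Prime]
    (ι : PadicAlgCl p ≃+* ℂ) (ι' : PadicAlgCl ℓ ≃+* ℂ) {E : Type*} [Semiring E]
    (ep : E →+* PadicAlgCl p) (eℓ : E →+* PadicAlgCl ℓ) (hι : ∀ x : E, ι' (eℓ x) = ι (ep x))
    {P : Polynomial E} {S : Polynomial ℂ} (h : P.map ep = S.map (ι.symm : ℂ →+* PadicAlgCl p)) :
    P.map eℓ = S.map (ι'.symm : ℂ →+* PadicAlgCl ℓ) := by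
  have heℓ : eℓ = (ι'.symm : ℂ →+* PadicAlgCl ℓ).comp ((ι : PadicAlgCl p →+* ℂ).comp ep) :=
    RingHom.ext fun x => (ι'.eq_symm_apply.mpr (hι x) : eℓ x = ι'.symm (ι (ep x)))
  have hS : S = P.map ((ι : PadicAlgCl p →+* ℂ).comp ep) := by
    rw [← Polynomial.map_map, h, Polynomial.map_map, RingEquiv.comp_symm, Polynomial.map_id]
  rw [hS, heℓ, Polynomial.map_map]

/-- **Partner transport of Satake–Frobenius compatibility through a prescribed `ι'`** (any rank
`n`, any two primes `p, ℓ`).  Let `π` on `GL_n(𝔸_K)` be Satake–Frobenius compatible a.e. with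
`ρ : Γ_K → GL_n(ℚ̄_p)` through `ι`, and let `ρ' : Γ_K → GL_n(ℚ̄_ℓ)` be an `E`-rational partner of
`ρ`: a.e. the polynomial `P_v ∈ E[X]` is the Frobenius polynomial of `ρ` through `e_p` and of
`ρ'` through `e_ℓ`, `ρ'` unramified.  Then `π` is Satake–Frobenius compatible a.e. with `ρ'`
through every `ι' : ℚ̄_ℓ ≃ ℂ` with `ι' ∘ e_ℓ = ι ∘ e_p`.  Proof: uniqueness of Frobenius
polynomials (`GaloisRep.HasFrobCharpolyAt.unique_holds`) gives `e_p(P_v) = ι⁻¹(∏ (X - α_j⁻¹))`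
(`arithFrobPolyOfSatake_one_eq_map`), whence `e_ℓ(P_v) = ι'⁻¹(∏ (X - α_j⁻¹))`
(`map_eq_map_symm_of_map_eq_map_symm`). [cite: SerreAbelianLadic1968, Ch. I §2.3] -/
theorem eventually_satakeFrobCompatibleAt_of_partner_of_apply_eq
    {K : Type} [Field K] [NumberField K] {n : ℕ}
    {hcpt : Literature.NumberTheory.Automorphic.isCompact_glFiniteIntegralLevel n K}
    {p ℓ : ℕ} [Fact p.Prime] [Fact ℓ.Prime] (ι : PadicAlgCl p ≃+* ℂ) (ι' : PadicAlgCl ℓ ≃+* ℂ)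
    (π : Literature.NumberTheory.Automorphic.AutomorphicRepData (Literature.NumberTheory.Automorphic.AutomorphyDatum.gl n K hcpt))
    (ρ : Literature.NumberTheory.GaloisRepresentations.FramedGaloisRep K (PadicAlgCl p) n)
    (ρ' : Literature.NumberTheory.GaloisRepresentations.FramedGaloisRep K (PadicAlgCl ℓ) n)
    (E : Type) [Field E] (ep : E →+* PadicAlgCl p) (eℓ : E →+* PadicAlgCl ℓ)
    (hι : ∀ x : E, ι' (eℓ x) = ι (ep x))
    (P : IsDedekindDomain.HeightOneSpectrum (NumberField.RingOfIntegers K) → Polynomial E)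
    (hπ : ∀ᶠ v in Filter.cofinite, Summit.Langlands.SatakeFrobCompatibleAt ι π ρ v)
    (hpart : ∀ᶠ v in Filter.cofinite, ρ.HasFrobCharpolyAt v ((P v).map ep) ∧ ρ'.IsUnramifiedAt v ∧ ρ'.HasFrobCharpolyAt v ((P v).map eℓ)) :
    ∀ᶠ v in Filter.cofinite, Summit.Langlands.SatakeFrobCompatibleAt ι' π ρ' v := by
  filter_upwards [hπ, hpart] with v hv hv'
  obtain ⟨α, hα, -, hcp⟩ := hv
  obtain ⟨hPp, hur', hPℓ⟩ := hv'
  have h1 : (P v).map ep = arithFrobPolyOfSatake ι v.residueCard 1 α :=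
    GaloisRep.HasFrobCharpolyAt.unique_holds
      ((FramedGaloisRep.hasFrobCharpolyAt_toGaloisRep_iff v _ ρ).mpr hPp)
      ((FramedGaloisRep.hasFrobCharpolyAt_toGaloisRep_iff v _ ρ).mpr hcp)
  rw [Summit.Langlands.Langlands.Theorems.IrreducibleOffSector.arithFrobPolyOfSatake_one_eq_map] at h1
  refine ⟨α, hα, hur', ?_⟩
  rw [Summit.Langlands.Langlands.Theorems.IrreducibleOffSector.arithFrobPolyOfSatake_one_eq_map,
    ← map_eq_map_symm_of_map_eq_map_symm ι ι' ep eℓ hι h1]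
  exact hPℓ

/-- **Partner transport, `∃ ι'` form** (any rank `n`, any two primes `p, ℓ`, `E` a number field).
In the situation of `eventually_satakeFrobCompatibleAt_of_partner_of_apply_eq` with `E` a number
field, there EXISTS `ι' : ℚ̄_ℓ ≃ ℂ` agreeing with `ι` on `E` (`ι' ∘ e_ℓ = ι ∘ e_p`), and through it
`π` is Satake–Frobenius compatible a.e. with the partner `ρ'`.  Existence of `ι'`: pick any
`ι₀ : ℚ̄_ℓ ≃ ℂ` (Steinitz, `PadicAlgCl.nonempty_ringEquiv_complex`); the two embeddings
`ι₀ ∘ e_ℓ, ι ∘ e_p : E → ℂ` of the countable field `E` differ by some `σ ∈ Aut(ℂ)`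
(`Literature.FieldTheory.AlgClosed.exists_ringEquiv_apply_eq`); take `ι' := σ ∘ ι₀`.
[cite: SerreAbelianLadic1968, Ch. I §2.3] -/
theorem exists_ringEquiv_eventually_satakeFrobCompatibleAt_of_partner
    {K : Type} [Field K] [NumberField K] {n : ℕ}
    {hcpt : Literature.NumberTheory.Automorphic.isCompact_glFiniteIntegralLevel n K}
    {p ℓ : ℕ} [Fact p.Prime] [Fact ℓ.Prime] (ι : PadicAlgCl p ≃+* ℂ)
    (π : Literature.NumberTheory.Automorphic.AutomorphicRepData (Literature.NumberTheory.Automorphic.AutomorphyDatum.gl n K hcpt))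
    (ρ : Literature.NumberTheory.GaloisRepresentations.FramedGaloisRep K (PadicAlgCl p) n)
    (ρ' : Literature.NumberTheory.GaloisRepresentations.FramedGaloisRep K (PadicAlgCl ℓ) n)
    (E : Type) [Field E] [NumberField E] (ep : E →+* PadicAlgCl p) (eℓ : E →+* PadicAlgCl ℓ)
    (P : IsDedekindDomain.HeightOneSpectrum (NumberField.RingOfIntegers K) → Polynomial E)
    (hπ : ∀ᶠ v in Filter.cofinite, Summit.Langlands.SatakeFrobCompatibleAt ι π ρ v)
    (hpart : ∀ᶠ v in Filter.cofinite, ρ.HasFrobCharpolyAt v ((P v).map ep) ∧ ρ'.IsUnramifiedAt v ∧ ρ'.HasFrobCharpolyAt v ((P v).map eℓ)) :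
    ∃ ι' : PadicAlgCl ℓ ≃+* ℂ, (∀ x : E, ι' (eℓ x) = ι (ep x)) ∧
      ∀ᶠ v in Filter.cofinite, Summit.Langlands.SatakeFrobCompatibleAt ι' π ρ' v := by
  obtain ⟨ι₀⟩ := PadicAlgCl.nonempty_ringEquiv_complex ℓ
  have hΩ : Cardinal.aleph0 < Cardinal.mk ℂ := by
    rw [Cardinal.mk_complex]; exact Cardinal.aleph0_lt_continuum
  haveI : Countable E := Countable.of_equiv _ (Module.finBasis ℚ E).equivFun.toEquiv.symm
  obtain ⟨σ, hσ⟩ := Literature.FieldTheory.AlgClosed.exists_ringEquiv_apply_eq hΩ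
    (Cardinal.mk_le_aleph0 (α := E)) ((ι₀ : PadicAlgCl ℓ →+* ℂ).comp eℓ)
    ((ι : PadicAlgCl p →+* ℂ).comp ep)
  have hι' : ∀ x : E, (ι₀.trans σ) (eℓ x) = ι (ep x) := fun x => by
    rw [RingEquiv.trans_apply]
    exact hσ x
  exact ⟨ι₀.trans σ, hι', eventually_satakeFrobCompatibleAt_of_partner_of_apply_eq ι (ι₀.trans σ)
    π ρ ρ' E ep eℓ hι' P hπ hpart⟩

end Summit.Langlands.Langlands.Theorems.EisensteinEntry

end
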